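import Mathlib
import Summits.NavierStokesRegularity.NavierStokesRegularity.Theorems.EulerZoomLiouvillePowerGaugeEulerLiouvilleSmallTypeIGradient
import HarnessLib.Audit

/-!
# Crux `EulerZoomLiouville.PowerGaugeEulerLiouville`: TYPE-I CLASSICAL MEMBERS THAT WERE SMALL-TYPE-I IN THE FAR PAST ARE TRIVIAL
# (stratum of `stub_nonSelfSimilarRest`: the small-gradient hypothesis is needed only for `τ < T₀`)

Route №10 `EulerZoomLiouville` (NavierStokesRegularity), crux E = stmt-NavierStokesRegularity-19832, registered residue
`stub_nonSelfSimilarRest`.  Lineage ns-typeII-p1 (gen 8).  Sequel to `…SmallTypeIGradient`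
(`KelvinPhysical.ae_eq_zero_of_gauge_of_smallTypeI`: `‖∇u(τ)‖ ≤ K/(−τ)` for ALL `τ < 0` with `K < 1` ⇒ trivial).

The constant `K < 1` is needed ONLY IN THE FAR PAST: if a classical member has a Type-I gradient bound `‖∇u(τ)‖_∞ ≤ K'/(−τ)`
(any `K'`, so that particle trajectories exist on the whole past — hypothesis (d) of the concentrating stratum) and
`‖∇u(τ)‖_∞ ≤ K/(−τ)` with `K < 1` for `τ < T₀` only, then the flow is irrotational before `T₀` (the ancient Chae threshold applied
to the time-translate `u(· + T₀)`, whose Type-I constant is again `K` because `K/(−(s+T₀)) ≤ K/(−s)`), and vorticity that vanishes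
at one time vanishes at all later times along trajectories (Cauchy formula) — so `curl u ≡ 0` on the whole past and the member
is trivial.  Near the putative blow-up time the Type-I constant is FREE.

* `curl_eq_zero_of_curl_eq_zero_at` — transport: `curl u(τ') ≡ 0`, `τ' < τ < 0`, Type-I gradient (any constant) ⇒ `curl u(τ) ≡ 0`;
* `curl_eq_zero_of_eventually_smallTypeI` — `K < 1` for `τ < T₀` (+ any Type-I constant globally) ⇒ `curl u ≡ 0`;
* **`ae_eq_zero_of_gauge_of_eventually_smallTypeI`** — MEMBER LEVEL, crux hypotheses verbatim (any `ρ > −1`).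

WHAT THIS IS NOT: not NS, not E — members whose Type-I gradient constant is `≥ 1` all the way to `τ = −∞` (every putative
self-similar one) and the weak class are untouched. [cite: Chae2010, Thm 1.1 (ancient form); MajdaBertozziCUP2002 §2.5 (2.115)–(2.117)]
-/

noncomputable section

-- flat `Theorems/<Route><Decl>…` files of one crux share the namespace of the crux (tree convention)
set_option linter.dupNamespace false

open MeasureTheory Set Filter Topology Metric Function InnerProductSpace
open scoped RealInnerProductSpace NNReal ENNReal ContDiff

namespace Summit.NavierStokesRegularity.NavierStokesRegularity.Theorems.PowerGaugeEulerLiouville.KelvinPhysical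

open Literature.Analysis Literature.Analysis.FunctionSpaces Literature.Analysis.FluidPDE

variable {u : ℝ → EuclideanSpace ℝ (Fin 3) → EuclideanSpace ℝ (Fin 3)}
  {p : ℝ → EuclideanSpace ℝ (Fin 3) → ℝ}

/-- **Vorticity that vanishes at one time vanishes later** (Type-I gradient bound with any constant, so that trajectories exist):
`curl u(τ₀) ≡ 0`, `τ₀ < τ < 0` ⇒ `curl u(τ) ≡ 0` (Cauchy formula `ω(x,τ) = ∇X · ω(τ₀) ∘ X⁻¹` for the time-translated flow).
[cite: MajdaBertozziCUP2002, §2.5 eqs. (2.115)–(2.117)] -/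
theorem curl_eq_zero_of_curl_eq_zero_at (hcl : IsClassicalEulerSolutionOn (Iio 0) 0 u p) {K : ℝ} (hK0 : 0 ≤ K)
    (hK : ∀ σ : ℝ, σ < 0 → ∀ x, ‖fderiv ℝ (u σ) x‖ ≤ K / (-σ)) {τ₀ τ : ℝ} (h0 : τ₀ < τ) (hτ : τ < 0)
    (hzero : ∀ x, curl (u τ₀) x = 0) (x : EuclideanSpace ℝ (Fin 3)) : curl (u τ) x = 0 := by
  have hτ₀ : τ₀ < 0 := h0.trans hτ
  have hnτ₀ : 0 < -τ₀ := by linarith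
  have hnτ : 0 < -τ := by linarith
  -- the time-translated flow `v t = u (t + τ₀)` on `(−∞, −τ₀) ∋ 0`
  set v : ℝ → EuclideanSpace ℝ (Fin 3) → EuclideanSpace ℝ (Fin 3) := fun t => u (t + τ₀) with hv
  set q : ℝ → EuclideanSpace ℝ (Fin 3) → ℝ := fun t => p (t + τ₀) with hq
  set S : Set ℝ := Iio (-τ₀) with hSdef
  have hclv : IsClassicalEulerSolutionOn S 0 v q := by
    have h1 := hcl.comp_add_right τ₀
    refine h1.mono (fun t ht => ?_) (uniqueDiffOn_Iio (-τ₀))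
    show t + τ₀ < 0
    rw [hSdef, mem_Iio] at ht
    linarith
  have hS : Convex ℝ S := convex_Iio _
  have hU : UniqueDiffOn ℝ S := uniqueDiffOn_Iio _
  have h0S : (0 : ℝ) ∈ S := by rw [hSdef, mem_Iio]; linarith
  -- Cauchy–Lipschitz on `S`: the gradient of `v t` is bounded by `K/(−(t₁+τ₀))` on compact `C ⊆ S` with top `t₁`
  have hLv : ODE.IsUniformlyLipschitzOn v S := by
    refine hclv.smooth_velocity.isUniformlyLipschitzOn_of_norm_fderiv_le fun C hC hCS => ?_
    rcases C.eq_empty_or_nonempty with rfl | hne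
    · exact ⟨0, fun t ht => absurd ht (notMem_empty t)⟩
    obtain ⟨t₁, ht₁C, ht₁⟩ := hC.exists_isMaxOn hne continuous_id.continuousOn
    have ht₁S : t₁ + τ₀ < 0 := by have := hCS ht₁C; rw [hSdef, mem_Iio] at this; linarith
    refine ⟨K / (-(t₁ + τ₀)), fun t ht y => ?_⟩
    have htS : t + τ₀ < 0 := by have := hCS ht; rw [hSdef, mem_Iio] at this; linarith
    have hle : t ≤ t₁ := ht₁ ht
    calc ‖fderiv ℝ (v t) y‖ = ‖fderiv ℝ (u (t + τ₀)) y‖ := rfl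
      _ ≤ K / (-(t + τ₀)) := hK _ htS y
      _ ≤ K / (-(t₁ + τ₀)) := div_le_div_of_nonneg_left hK0 (by linarith) (by linarith)
  -- the time `t = τ − τ₀ ∈ S`, `t > 0`
  set t : ℝ := τ - τ₀ with htdef
  have ht0 : 0 ≤ t := by rw [htdef]; linarith
  have htS : t ∈ S := by rw [hSdef, mem_Iio, htdef]; linarith
  -- Cauchy formula in Eulerian form at time `t` of `v`
  set a : EuclideanSpace ℝ (Fin 3) := ODE.evolutionMap v t 0 x with ha
  have hcauchy := hclv.curl_eq_fderiv_evolutionMap_apply hS h0S hU hLv htS x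
  have hvt : v t = u τ := by simp [hv, htdef]
  have hv0 : v 0 = u τ₀ := by simp [hv]
  rw [← hvt, hcauchy, hv0, hzero, map_zero]

/-- **Small Type-I in the far past ⇒ irrotational on the whole past**: Type-I gradient with any constant `K'` on `(−∞,0)` and with
`K < 1` on `(−∞, T₀)` ⇒ `curl u(τ) ≡ 0` for every `τ < 0`. [cite: Chae2010, Thm 1.1 (ancient form)] -/
theorem curl_eq_zero_of_eventually_smallTypeI (hcl : IsClassicalEulerSolutionOn (Iio 0) 0 u p)
    {K' : ℝ} (hK' : ∀ σ : ℝ, σ < 0 → ∀ x, ‖fderiv ℝ (u σ) x‖ ≤ K' / (-σ))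
    {K T₀ : ℝ} (hT₀ : T₀ < 0) (hK1 : K < 1) (hK : ∀ σ : ℝ, σ < T₀ → ∀ x, ‖fderiv ℝ (u σ) x‖ ≤ K / (-σ))
    {τ : ℝ} (hτ : τ < 0) (x : EuclideanSpace ℝ (Fin 3)) : curl (u τ) x = 0 := by
  -- `K ≥ 0` (the bound at one point) and `K' ≥ 0`
  have hK0 : 0 ≤ K := by
    have h := hK (T₀ - 1) (by linarith) x
    by_contra hneg
    push Not at hneg
    have : K / (-(T₀ - 1)) < 0 := div_neg_of_neg_of_pos hneg (by linarith)
    linarith [norm_nonneg (fderiv ℝ (u (T₀ - 1)) x)]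
  have hK'0 : 0 ≤ K' := by
    have h := hK' τ hτ x
    by_contra hneg
    push Not at hneg
    have : K' / (-τ) < 0 := div_neg_of_neg_of_pos hneg (by linarith)
    linarith [norm_nonneg (fderiv ℝ (u τ) x)]
  -- Step 1: irrotational before `T₀` — the translate `w s = u (s + T₀)` is small-Type-I on the whole past
  have hpast : ∀ σ : ℝ, σ < T₀ → ∀ y, curl (u σ) y = 0 := by
    intro σ hσ y
    set w : ℝ → EuclideanSpace ℝ (Fin 3) → EuclideanSpace ℝ (Fin 3) := fun s => u (s + T₀) with hw
    set r : ℝ → EuclideanSpace ℝ (Fin 3) → ℝ := fun s => p (s + T₀) with hr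
    have hclw : IsClassicalEulerSolutionOn (Iio 0) 0 w r := by
      have h1 := hcl.comp_add_right T₀
      refine h1.mono (fun s hs => ?_) (uniqueDiffOn_Iio 0)
      show s + T₀ < 0
      rw [mem_Iio] at hs
      linarith
    have hKw : ∀ s : ℝ, s < 0 → ∀ y, ‖fderiv ℝ (w s) y‖ ≤ K / (-s) := by
      intro s hs y
      have h1 : ‖fderiv ℝ (u (s + T₀)) y‖ ≤ K / (-(s + T₀)) := hK (s + T₀) (by linarith) y
      have h2 : K / (-(s + T₀)) ≤ K / (-s) := div_le_div_of_nonneg_left hK0 (by linarith) (by linarith)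
      exact h1.trans h2
    have h := curl_eq_zero_of_smallTypeI hclw hK1 hKw (τ := σ - T₀) (by linarith) y
    simpa [hw] using h
  -- Step 2: transport to later times
  by_cases hτT : τ < T₀
  · exact hpast τ hτT x
  · push Not at hτT
    exact curl_eq_zero_of_curl_eq_zero_at hcl hK'0 hK' (τ₀ := T₀ - 1) (by linarith) hτ (hpast (T₀ - 1) (by linarith)) x

/-! ### Member level -/

/-- **TYPE-I CLASSICAL MEMBERS THAT WERE SMALL-TYPE-I IN THE FAR PAST ARE TRIVIAL.**  Crux hypotheses verbatim (any `ρ > −1`)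
+ `(u, p)` classical on the past + `‖∇u(τ, x)‖ ≤ K'/(−τ)` for all `τ < 0` (any `K'`) + `‖∇u(τ, x)‖ ≤ K/(−τ)` for `τ < T₀` with
`K < 1` ⇒ `u = 0` a.e. on `(−∞,0) × ℝ³`. [cite: Chae2010, Thm 1.1 (ancient form); folklore (irrotational tail)] -/
theorem ae_eq_zero_of_gauge_of_eventually_smallTypeI {ρ : ℝ} (hρ : -1 < ρ)
    {H : ℝ → EuclideanSpace ℝ (Fin 3) → EuclideanSpace ℝ (Fin 3) →L[ℝ] EuclideanSpace ℝ (Fin 3)}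
    {c : ℝ≥0}
    (hsw : IsSuitableWeakSolutionOn (slab (EuclideanSpace ℝ (Fin 3)) (Iio 0) isOpen_Iio) 0 0 u p)
    (hH : HasWeakSpatialGradientOn (slab (EuclideanSpace ℝ (Fin 3)) (Iio 0) isOpen_Iio) u H)
    (hgauge : ∀ a : ℝ, 0 < a →
      ENNReal.ofReal (a ^ (2 * ρ)) * cknA a (0 : ℝ × EuclideanSpace ℝ (Fin 3)) u +
          ENNReal.ofReal (a ^ ρ) * cknE a (0 : ℝ × EuclideanSpace ℝ (Fin 3)) H +
        ENNReal.ofReal (a ^ (2 * ρ)) * cknD a (0 : ℝ × EuclideanSpace ℝ (Fin 3)) p ≤ (c : ℝ≥0∞))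
    (hcl : IsClassicalEulerSolutionOn (Iio 0) 0 u p)
    {K' : ℝ} (hK' : ∀ τ : ℝ, τ < 0 → ∀ x, ‖fderiv ℝ (u τ) x‖ ≤ K' / (-τ))
    {K T₀ : ℝ} (hT₀ : T₀ < 0) (hK1 : K < 1) (hK : ∀ τ : ℝ, τ < T₀ → ∀ x, ‖fderiv ℝ (u τ) x‖ ≤ K / (-τ)) :
    uncurry u =ᵐ[volume.restrict (Iio (0 : ℝ) ×ˢ (univ : Set (EuclideanSpace ℝ (Fin 3))))] 0 := by
  have hcurl0 : ∀ τ : ℝ, τ < 0 → ∀ x, curl (u τ) x = 0 :=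
    fun τ hτ x => curl_eq_zero_of_eventually_smallTypeI hcl hK' hT₀ hK1 hK hτ x
  -- irrotational classical members are trivial (the tail of `ae_eq_zero_of_gauge_of_concentrating`)
  have h1 := ae_hasWeakGradient_slice_of_slab hH
  have h2 : ∀ᵐ t ∂(volume.restrict (Iio (0 : ℝ))),
      (fun x => H t x) =ᵐ[volume] fun x => fderiv ℝ (u t) x := by
    filter_upwards [h1, ae_restrict_mem measurableSet_Iio] with t ht htneg
    have hcl1 : ContDiff ℝ 1 (u t) := (hcl.contDiff_velocity htneg).of_le (by exact_mod_cast le_top)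
    have hw : HasWeakGradient (u t) (fderiv ℝ (u t)) := hasWeakGradient_fderiv_of_contDiff hcl1
    have := HasWeakFDerivOn.unique_holds ht hw
    rwa [TopologicalSpace.Opens.coe_top, Measure.restrict_univ] at this
  have hμ : (volume : Measure (ℝ × EuclideanSpace ℝ (Fin 3))).restrict
      (Iio (0 : ℝ) ×ˢ (univ : Set (EuclideanSpace ℝ (Fin 3)))) =
      (volume.restrict (Iio (0 : ℝ))).prod (volume : Measure (EuclideanSpace ℝ (Fin 3))) := by
    rw [Measure.volume_eq_prod, Measure.restrict_prod_eq_prod_univ]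
  have hHm : AEStronglyMeasurable (uncurry H)
      ((volume.restrict (Iio (0 : ℝ))).prod (volume : Measure (EuclideanSpace ℝ (Fin 3)))) := by
    have := hH.locallyIntegrableOn_grad.aestronglyMeasurable
    rw [← hμ]; simpa [slab] using this
  have hGcont : ContinuousOn (uncurry fun t x => fderiv ℝ (u t) x)
      (Iio (0 : ℝ) ×ˢ (univ : Set (EuclideanSpace ℝ (Fin 3)))) :=
    (hcl.smooth_velocity.fderiv_slice isOpen_Iio.uniqueDiffOn).continuousOn
  have hGm : AEStronglyMeasurable (uncurry fun t x => fderiv ℝ (u t) x)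
      ((volume.restrict (Iio (0 : ℝ))).prod (volume : Measure (EuclideanSpace ℝ (Fin 3)))) := by
    rw [← hμ]
    exact hGcont.aestronglyMeasurable (measurableSet_Iio.prod MeasurableSet.univ)
  have hHG : uncurry H =ᵐ[(volume.restrict (Iio (0 : ℝ))).prod volume]
      uncurry fun t x => fderiv ℝ (u t) x :=
    ae_eq_prod_of_ae_ae_eq hHm hGm h2
  have hsym : ∀ᵐ z ∂(volume.restrict (Iio (0 : ℝ) ×ˢ (univ : Set (EuclideanSpace ℝ (Fin 3))))),
      ∀ v w : EuclideanSpace ℝ (Fin 3), ⟪H z.1 z.2 v, w⟫ = ⟪H z.1 z.2 w, v⟫ := by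
    rw [hμ]
    have hmem : ∀ᵐ z ∂((volume.restrict (Iio (0 : ℝ))).prod
        (volume : Measure (EuclideanSpace ℝ (Fin 3)))), z.1 < 0 := by
      rw [← hμ]
      filter_upwards [ae_restrict_mem (measurableSet_Iio.prod MeasurableSet.univ)] with z hz
      exact hz.1
    filter_upwards [hHG, hmem] with z hz hzneg v w
    have e : H z.1 z.2 = fderiv ℝ (u z.1) z.2 := hz
    rw [e]
    exact inner_fderiv_comm_of_curl_eq_zero
      (((hcl.contDiff_velocity hzneg).differentiable (by simp)) z.2) (hcurl0 z.1 hzneg z.2) v w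
  exact ae_eq_zero_of_gauge_of_irrotational hρ hsw hH hgauge hsym

end Summit.NavierStokesRegularity.NavierStokesRegularity.Theorems.PowerGaugeEulerLiouville.KelvinPhysical

end
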